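import Literature.Barriers.CriticalPhenomena.GridSAWCountingSharpPComplete
import Literature.Computability.Complexity.StackBricks
import Literature.Computability.Complexity.StringEquality
import HarnessLib

/-!
# Towards `LOT2003_thm7_fixedLength_holds`: Proposition 1 (transitivity of the counting
# reductions), the intermediate problem `#HamPath` on grid-drawn graphs, and the decomposition of
# Theorem 7 (1) of Liśkiewicz–Ogihara–Toda 2003 into named sub-facts

Sibling file of `GridSAWCountingSharpPComplete.lean` (barrier catalogue
`Literature/Barriers/CriticalPhenomena/`, D-0021; the sibling `…Proofs.lean` discharges the
consequence `sharpP_subset_FP_of_hasPolyTimeSAWCount` and is independent of this file). The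
named fact
`GridSAW.LOT2003_thm7_fixedLength : IsSharpPCompleteRShift SAWCOUNT₁` (Theorem 7, version (1):
counting the SAWs of a subgraph of `ℤ²` from the origin to a given point with a given length is
complete for `#P` under `≤ᵖ_{r-shift}`-reductions) is, unfolded,
`SAWCOUNT₁ ∈ #P ∧ ∀ f ∈ #P, f ≤ᵖ_{r-shift} SAWCOUNT₁`. Its printed proof is a chain of four
results of the paper, none of which is in the tree:

* **Proposition 1** (§2.2): `≤ᵖ_{r-shift}` and `≤ᵖ_{parsimonious}` are transitive — PROVED here
  (`RShiftReducible.trans`, `ParsimoniousReducible.trans`, and the mixed forms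
  `RShiftReducible.trans_parsimonious`, `ParsimoniousReducible.trans_rShift`), from the tree's
  closure of `FP` under composition (`Literature.Computability.Complexity.comp_mem_FP`), fan-out
  (`Literature.Computability.Complexity.fanoutFn_mem_FP`) and binary addition (`Literature.Computability.Complexity.Brick.addFn_mem_FP`), the
  latter for `y div 2^a div 2^b = y div 2^(a+b)`;
* **Proposition 2** (§2.3, Valiant 1979): `#SAT`, `#3SAT` are complete for `#P` under
  parsimonious reductions; **Lemma 3**: a parsimonious normal form (NAE, `8m` three-literal
  clauses and one unit clause); **Lemma 4** (§3): "The problem of counting Hamiltonian paths in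
  planar graphs of maximum degree three is `#P`-complete under `≤ᵖ_{r-shift}`-reductions" (a
  corrected Garey–Johnson–Tarjan construction, each satisfying assignment of the normal form
  contributing exactly `2^{48r+12n+312m+25}` Hamiltonian `s`–`t` paths);
* **proof of Theorem 7** (§4), embedding step: "Let `R` be the reduction from `f` to `#HamPath`
  stated in Lemma 4. It is known that planar graphs can be embedded in two-dimensional grids in
  polynomial time … In the case when the maximum degree is three, the embedding can be made so
  that there is no vertex congestion, i.e. for every two edges the paths which realize the edges
  in the two-dimensional grid are vertex disjoint … This is `E₀`";
* **proof of Theorem 7**, tower step: `E₀` is enlarged by `4` (`E₁`), then by `L` (the least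
  power of two `≥ N²` and `≥` every edge-path length), and `I(e) = (L² − λ(e))/2L` "towers" of
  height `L` are inserted in every edge path, so that "for all edges `e` of `G′`, `e` is realized
  by a path of length `L²`" (`E₂`); with `h = L²(N+1)`, "every Hamiltonian path of `G′` is
  realized by a path in `E₂` of length `h`. Furthermore, every path in `E₂` having length `h`
  corresponds to a Hamiltonian path in `G′`", and `R₁(x) = (E₂, τ, h)`, `R₃` = that of Lemma 4.

## The decomposition (named sub-facts, to be discharged bottom-up; this file has tenure)

Mathlib and the tree have no notion of planarity of an abstract graph, and the proof of
Theorem 7 uses planarity only through the grid embedding it computes. The intermediate counting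
problem is therefore cut AFTER the embedding step: `GRIDHAMPATHCOUNT` counts the Hamiltonian
`s`–`t` paths of a graph of maximum degree three PRESENTED WITH a congestion-free grid drawing
(vertices ↦ distinct grid points, edges ↦ pairwise internally-disjoint grid paths;
`IsGridDrawing`), value `0` on invalid presentations (validity is a polynomial-time syntactic
check, so this is the promise problem `#HamPath-Plan3` of Lemma 4 with the promise made
checkable by carrying the drawing the proof of Theorem 7 computes anyway).

* `LOT2003_thm7_fixedLength_mem : SAWCOUNT₁ ∈ #P` — the membership half of "complete" in
  Theorem 7 (1) (not argued in print; a polynomial-time verifier of coded walks);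
* `LOT2003_lemma4_grid : ∀ f ∈ #P, f ≤ᵖ_{r-shift} GRIDHAMPATHCOUNT` — Lemma 4 composed with the
  embedding step of the proof of Theorem 7 (its own sub-DAG, for later sessions, lives in
  `Literature/Computability/Complexity/`: Proposition 2 = parsimonious Cook–Levin on the tree's
  tableau `CookLevinTableau.lean`, Lemma 3, and the gadget graph of §3 with an explicit layout);
* `LOT2003_thm7_fixedLength_towers : GRIDHAMPATHCOUNT ≤ᵖ_{parsimonious} SAWCOUNT₁` — the tower
  step;
* `LOT2003_thm7_fixedLength_of` — PROVED: the three sub-facts give `LOT2003_thm7_fixedLength`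
  (Proposition 1, mixed form). The discharge `LOT2003_thm7_fixedLength_holds` is this theorem
  applied to the three discharges, once they land.

Each sub-fact is weaker than, or a restatement of, what the source proves at the cited place;
none is used anywhere as an axiom.

## Status and audit (barrier audit 2026-08-15)

* DISCHARGED since this file was written (the phrase "none of which is in the tree" above is
  historical): `LOT2003_thm7_fixedLength_mem_holds` (`GridSAWCountingVerifier.lean`) and
  `LOT2003_thm7_fixedLength_towers_holds` (`GridSAWTowersMachine.lean`), both with axioms
  `propext`, `Classical.choice`, `Quot.sound` only. The middle fact `LOT2003_lemma4_grid` is cut in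
  `GridSAWCountingGridHamPathHardness.lean` into Proposition 2 (discharged:
  `Literature.Computability.Complexity.LOT2003_prop2_sharp3SAT_holds`), Lemma 3 (discharged:
  `Literature.Computability.Complexity.LOT2003_lemma3_holds`) and the single remaining named fact
  `LOT2003_lemma4_gadgets : SHARP3SATNF ≤ᵖ_{r-shift} GRIDHAMPATHCOUNT`, from which
  `LOT2003_lemma4_grid_of_gadgets` derives `LOT2003_lemma4_grid` and
  `gridSAWCountingSharpPComplete_of_gadgets` (`GridSAWCountingSharpPCompleteOfGadgets.lean`) the
  whole barrier. Those files import this one; nothing of this is restated here.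
* Audit of the open fact (refuter, 2026-08-15; verdict CONFIRMED). `LOT2003_lemma4_grid` and
  `LOT2003_lemma4_gadgets` are EXISTENTIAL over the reduction (no shift constant is fixed), so
  they hold as soon as any printed hardness proof for `#HamPath` on planar graphs of maximum
  degree three is right, and there are printed routes independent of the gadget census of §3:
  Seta (2002) proved ASP-completeness (parsimonious reductions with a solution bijection from
  every NP search problem) of Hamiltonicity in undirected planar graphs of maximum degree three,
  and Hamiltonian CYCLE on undirected maximum-degree-3 grid graphs (INDUCED subgraphs of `ℤ²`)
  is ASP-complete
  [cite: MITHardnessGroup2024, §1 (p. 2: "[LOT03] … [Set02] …") and Theorem 4.10].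
  On the grid-graph route no embedding algorithm is needed (a grid graph carries the identity
  drawing: `IsGridDrawing` with unit-edge paths). Cycles pass to `s`–`t` paths by deleting the
  lexicographically least vertex `v` (degree `≤ 2`, neighbours `v + (1,0)`, `v + (0,1)`) and
  taking its two neighbours as the ends; a parsimonious reduction becomes an r-shift one (which
  demands `R₃ ≥ 1`) by a doubling gadget at the end vertex `t` (of degree `≤ 2` there): four
  new vertices `a b c d`, edges `ta ab ac bc bd cd` (planar, maximum degree three, drawable beside
  the leftmost column), new end `d` — every Hamiltonian path ending at `t` has exactly the two
  completions `a b c d` and `a c b d`, and every Hamiltonian path to `d` arises so, the gadget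
  hanging off the bridge `ta` [folklore; brute-force checked on small instances in the audit];
  then `ParsimoniousReducible.trans_rShift` (below). This is recorded, informally, as an
  alternative discharge path for `LOT2003_lemma4_gadgets`/`LOT2003_lemma4_grid`: it trades the
  Garey–Johnson–Tarjan census and the grid embedding `E₀` for the TRVB chain of
  [cite: MITHardnessGroup2024, §3 and §4.3]. No narrowing: the Lean statements restate the source,
  and `GRIDHAMPATHCOUNT`'s instance class (arbitrary ends `s`, `t` of degree `≤ 3`, `s = t`
  allowed) is a superset of Lemma 4's outputs, for which the tower step is nevertheless proved.
* Embedding pointer. The source's reference for "planar graphs can be embedded in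
  two-dimensional grids in polynomial time (for example, see [4])" is a STRAIGHT-LINE grid
  drawing (vertices at grid points, edges straight segments) [cite: ChrobakPayne1995, abstract];
  the vertex-disjoint grid-PATH realisation of the edges that `E₀` uses ("no vertex
  congestion") is a planar ORTHOGONAL grid drawing, which exists exactly for planar graphs of
  maximum degree `≤ 4` and is computable in polynomial time from a planar embedding
  [cite: Tamassia1987, abstract (via Bertolazzi–Di Battista–Didimo, WADS 1997, LNCS 1272, §1)];
  the unit-step subdivision of such a drawing is an `IsGridDrawing` (edges of a planar drawing meet
  only at common end points, so distinct drawn paths share only vertex images). Immaterial for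
  the planned discharge, which lays out the specific gadget graph explicitly.

## References

* M. Liśkiewicz, M. Ogihara, S. Toda, *The complexity of counting self-avoiding walks in
  subgraphs of two-dimensional grids and hypercubes*, TCS 304 (2003) 129–156, §2.2 (Prop. 1),
  §2.3 (Prop. 2, Lemma 3), §3 (Lemma 4), §4 (Theorem 7 and its proof).
* L. G. Valiant, *The complexity of enumeration and reliability problems*, SIAM J. Comput. 8
  (1979) (parsimonious `#P`-completeness of `#SAT`; the paper's [26]).
* S. Arora, B. Barak, *Computational Complexity: A Modern Approach*, CUP 2009, §1.3 (closure of
  polynomial time under composition), §0.1 (codes).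
* MIT Hardness Group, J. Brunner, L. Chung, E. D. Demaine, J. Diomidova, D. Hendrickson,
  A. Tockman, *ASP-Completeness of Hamiltonicity in Grid Graphs, with Applications to Loop
  Puzzles*, FUN 2024 (LIPIcs 291) 23:1–23:20, arXiv:2405.08377, §1, §3, Theorem 4.10 (and the
  thesis of T. Seta, U. Tokyo 2002, cited there as [Set02]).
* M. Chrobak, T. H. Payne, *A linear-time algorithm for drawing a planar graph on a grid*, IPL 54
  (1995) 241–246 (the source's [4]: straight-line grid drawings).
* R. Tamassia, *On embedding a graph in the grid with the minimum number of bends*, SIAM J.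
  Comput. 16 (1987) 421–444 (planar orthogonal grid drawings of graphs of maximum degree four).
-/

noncomputable section

namespace Literature.Barriers.CriticalPhenomena.GridSAW

open _root_.Computability Literature.Computability.Complexity

/-! ### Parsimonious reductions and Proposition 1 -/

/-- **`f ≤ᵖ_{parsimonious} g`**: there is a polynomial-time `R₁ : Σ* → Σ*` with
`f(x) = g(R₁(x))` for all `x` (the case `R₂(x, y) = y` of a polynomial-time one-Turing
reduction). [cite: LiskiewiczOgiharaToda2003, §2.2 (definition of ≤ᵖ_parsimonious)] -/
def ParsimoniousReducible (f g : List Bool → ℕ) : Prop :=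
  ∃ R₁ : List Bool → List Bool, R₁ ∈ FP ∧ ∀ x, f x = g (R₁ x)

/-- Unfolding lemma for `ParsimoniousReducible`. [cite: LiskiewiczOgiharaToda2003, §2.2] -/
theorem parsimoniousReducible_iff (f g : List Bool → ℕ) :
    ParsimoniousReducible f g ↔ ∃ R₁ : List Bool → List Bool, R₁ ∈ FP ∧ ∀ x, f x = g (R₁ x) :=
  Iff.rfl

/-- `≤ᵖ_{parsimonious}` is reflexive (the identity is polynomial time).
[cite: LiskiewiczOgiharaToda2003, §2.2] -/
theorem ParsimoniousReducible.refl (f : List Bool → ℕ) : ParsimoniousReducible f f :=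
  ⟨fun z => z, PolyTimeComputable.id _, fun _ => rfl⟩

/-- **Proposition 1, parsimonious half**: `≤ᵖ_{parsimonious}` is transitive (compose the two
instance maps; `FP` is closed under composition). [cite: LiskiewiczOgiharaToda2003, Proposition 1] -/
theorem ParsimoniousReducible.trans {f g h : List Bool → ℕ} (hfg : ParsimoniousReducible f g)
    (hgh : ParsimoniousReducible g h) : ParsimoniousReducible f h := by
  obtain ⟨R, hR, hf⟩ := hfg
  obtain ⟨S, hS, hg⟩ := hgh
  exact ⟨S ∘ R, comp_mem_FP hS hR, fun x => by rw [hf, hg]; rfl⟩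

/-- **Proposition 1, right-bit-shift half**: `≤ᵖ_{r-shift}` is transitive. If
`f(x) = g(R₁ x) div 2^{R₃ x}` and `g(y) = h(S₁ y) div 2^{S₃ y}` then
`f(x) = h(S₁ (R₁ x)) div 2^{S₃ (R₁ x) + R₃ x}`; the new shift `x ↦ S₃(R₁ x) + R₃ x` is positive
and polynomial-time in binary (fan-out, then the tree's binary adder `Brick.addFn`).
[cite: LiskiewiczOgiharaToda2003, Proposition 1] -/
theorem RShiftReducible.trans {f g h : List Bool → ℕ} (hfg : RShiftReducible f g)
    (hgh : RShiftReducible g h) : RShiftReducible f h := by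
  obtain ⟨R₁, hR₁, R₃, hR₃, hR₃pos, hf⟩ := hfg
  obtain ⟨S₁, hS₁, S₃, hS₃, _hS₃pos, hg⟩ := hgh
  refine ⟨S₁ ∘ R₁, comp_mem_FP hS₁ hR₁, fun x => S₃ (R₁ x) + R₃ x, ?_,
    fun x => Nat.add_pos_right _ (hR₃pos x), fun x => ?_⟩
  · have hcomp : (encodeNat ∘ fun x => S₃ (R₁ x) + R₃ x) =
        Brick.addFn ∘ fanoutFn ((encodeNat ∘ S₃) ∘ R₁) (encodeNat ∘ R₃) := by
      funext x
      simp [fanoutFn_apply, Brick.addFn_boolPair, bitsToNat_encodeNat]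
    rw [hcomp]
    exact comp_mem_FP Brick.addFn_mem_FP (fanoutFn_mem_FP (comp_mem_FP hS₃ hR₁) hR₃)
  · rw [hf, hg, Function.comp_apply, Nat.div_div_eq_div_mul, ← pow_add]

/-- Mixed form of Proposition 1 used by Theorem 7: `f ≤ᵖ_{r-shift} g` and
`g ≤ᵖ_{parsimonious} h` give `f ≤ᵖ_{r-shift} h` (same shift, composed instance map).
[cite: LiskiewiczOgiharaToda2003, Proposition 1 and proof of Theorem 7 ("the pair (R₁, R₃) witnesses …")] -/
theorem RShiftReducible.trans_parsimonious {f g h : List Bool → ℕ} (hfg : RShiftReducible f g)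
    (hgh : ParsimoniousReducible g h) : RShiftReducible f h := by
  obtain ⟨R₁, hR₁, R₃, hR₃, hpos, hf⟩ := hfg
  obtain ⟨S, hS, hg⟩ := hgh
  exact ⟨S ∘ R₁, comp_mem_FP hS hR₁, R₃, hR₃, hpos, fun x => by rw [hf, hg]; rfl⟩

/-- Mixed form of Proposition 1: `f ≤ᵖ_{parsimonious} g` and `g ≤ᵖ_{r-shift} h` give
`f ≤ᵖ_{r-shift} h` (shift `S₃ ∘ R₁`). [cite: LiskiewiczOgiharaToda2003, Proposition 1] -/
theorem ParsimoniousReducible.trans_rShift {f g h : List Bool → ℕ}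
    (hfg : ParsimoniousReducible f g) (hgh : RShiftReducible g h) : RShiftReducible f h := by
  obtain ⟨R, hR, hf⟩ := hfg
  obtain ⟨S₁, hS₁, S₃, hS₃, hpos, hg⟩ := hgh
  exact ⟨S₁ ∘ R, comp_mem_FP hS₁ hR, S₃ ∘ R, comp_mem_FP hS₃ hR, fun x => hpos (R x),
    fun x => by rw [hf, hg]; rfl⟩

/-- Completeness transfer along a parsimonious reduction: if every `#P` function is
`≤ᵖ_{r-shift}`-reducible to `g`, `g ≤ᵖ_{parsimonious} h` and `h ∈ #P`, then `h` is complete for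
`#P` under `≤ᵖ_{r-shift}`-reductions. [cite: LiskiewiczOgiharaToda2003, Proposition 1 and proof of Theorem 7] -/
theorem isSharpPCompleteRShift_of_parsimonious {g h : List Bool → ℕ}
    (hg : ∀ f ∈ SharpP, RShiftReducible f g) (hgh : ParsimoniousReducible g h)
    (hh : h ∈ SharpP) : IsSharpPCompleteRShift h :=
  ⟨hh, fun f hf => (hg f hf).trans_parsimonious hgh⟩

/-! ### `#HamPath` for graphs of maximum degree three presented with a grid drawing -/

/-- A **drawn edge** `(i, j, π)`: the end vertices `i ≠ j` (indices into the list of vertex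
images) and the grid path `π` realising the edge, listed with all its points from the image of
`i` to the image of `j`. [cite: LiskiewiczOgiharaToda2003, §4, proof of Theorem 7 ("the paths which realize the edges in the two-dimensional grid")] -/
abbrev DrawnEdge : Type := ℕ × ℕ × List GridPoint

/-- An instance `(P, D, s, t)` of `#HamPath` with a grid drawing: the vertex images `P`
(vertex `v < N := P.length` is drawn at `P[v]`), the drawn edges `D`, and the end vertices
`s`, `t`. [cite: LiskiewiczOgiharaToda2003, §2.3 (#HamPath: "given a graph G and a node pair (s, t)") and §4 (proof of Theorem 7, E₀)] -/
abbrev DrawnGraphInstance : Type := List GridPoint × List DrawnEdge × ℕ × ℕ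

/-- Adjacency of the abstract graph with edge list `D` (edges are undirected).
[cite: LiskiewiczOgiharaToda2003, §2.3] -/
def DAdj (D : List DrawnEdge) (a b : ℕ) : Prop :=
  ∃ e ∈ D, (e.1 = a ∧ e.2.1 = b) ∨ (e.1 = b ∧ e.2.1 = a)

/-- **A Hamiltonian `s`–`t` path** of the abstract graph on the vertices `0, …, N - 1` with
edge list `D`, as its vertex list: a permutation of `[0, …, N-1]` from `s` to `t` with
consecutive vertices adjacent (the support list of a `SimpleGraph.Walk` that `IsHamiltonian`
in Mathlib's sense, `Mathlib/Combinatorics/SimpleGraph/Hamiltonian.lean`: every vertex occurs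
exactly once). [cite: LiskiewiczOgiharaToda2003, §2.3 (Hamiltonian Path, #HamPath)] -/
def IsHamPath (N : ℕ) (D : List DrawnEdge) (s t : ℕ) (l : List ℕ) : Prop :=
  l.Perm (List.range N) ∧ l.head? = some s ∧ l.getLast? = some t ∧ List.IsChain (DAdj D) l

/-- **`#HamPath`**: the number of Hamiltonian `s`–`t` paths (a finite set:
`isHamPath_finite`). [cite: LiskiewiczOgiharaToda2003, §2.3 (#HamPath)] -/
def hamPathCount (N : ℕ) (D : List DrawnEdge) (s t : ℕ) : ℕ :=
  {l | IsHamPath N D s t l}.ncard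

/-- The Hamiltonian paths form a finite set (they are among the permutations of
`[0, …, N-1]`), so `hamPathCount` is an honest cardinality. [folklore] -/
theorem isHamPath_finite (N : ℕ) (D : List DrawnEdge) (s t : ℕ) :
    {l | IsHamPath N D s t l}.Finite :=
  (List.range N).permutations.finite_toSet.subset fun _ h => List.mem_permutations.mpr h.1

/-- Two drawn edges have the same pair of end vertices (in either order): excluded below, the
abstract graph being simple. [cite: LiskiewiczOgiharaToda2003, §2.3] -/
def SameEnds (e e' : DrawnEdge) : Prop :=
  (e.1 = e'.1 ∧ e.2.1 = e'.2.1) ∨ (e.1 = e'.2.1 ∧ e.2.1 = e'.1)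

/-- The drawn edge `(i, j, π)` is correctly drawn with respect to the vertex images `P`:
`i, j < N` are distinct vertices, `π` is a self-avoiding grid path from `P[i]` to `P[j]`, and
`π` meets the vertex images only at its two ends.
[cite: LiskiewiczOgiharaToda2003, §4, proof of Theorem 7 (embedding without vertex congestion)] -/
def IsDrawnEdgeOf (P : List GridPoint) (e : DrawnEdge) : Prop :=
  e.1 < P.length ∧ e.2.1 < P.length ∧ e.1 ≠ e.2.1 ∧
    e.2.2.head? = P[e.1]? ∧ e.2.2.getLast? = P[e.2.1]? ∧ e.2.2.Nodup ∧
    List.IsChain IsGridEdge e.2.2 ∧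
    ∀ p ∈ e.2.2, p ∈ P → (P[e.1]? = some p ∨ P[e.2.1]? = some p)

/-- The number of drawn edges incident with the vertex `v`. [cite: LiskiewiczOgiharaToda2003, §2.3 ("maximum-degree three")] -/
def drawnDegree (D : List DrawnEdge) (v : ℕ) : ℕ :=
  D.countP fun e => decide (e.1 = v ∨ e.2.1 = v)

/-- **`(P, D)` is a congestion-free grid drawing of a simple graph of maximum degree three**:
distinct vertex images; every edge correctly drawn (`IsDrawnEdgeOf`); no two drawn edges with
the same ends (simple graph); any point common to two drawn edges is a vertex image (hence a
common end point: "for every two edges the paths which realize the edges in the two-dimensional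
grid are vertex disjoint"); every vertex has at most three incident edges ("planar graphs having
maximum-degree three"). A polynomial-time decidable, purely syntactic condition.
[cite: LiskiewiczOgiharaToda2003, §2.3 (#HamPath-Plan3) and §4, proof of Theorem 7 (E₀)] -/
def IsGridDrawing (P : List GridPoint) (D : List DrawnEdge) : Prop :=
  P.Nodup ∧ (∀ e ∈ D, IsDrawnEdgeOf P e) ∧ D.Pairwise (fun e e' => ¬ SameEnds e e') ∧
    D.Pairwise (fun e e' => ∀ p ∈ e.2.2, p ∈ e'.2.2 → p ∈ P) ∧
    ∀ v < P.length, drawnDegree D v ≤ 3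

/-- Decidability of `SameEnds`. [folklore] -/
instance (e e' : DrawnEdge) : Decidable (SameEnds e e') := by
  unfold SameEnds; infer_instance

/-- Decidability of `IsDrawnEdgeOf`. [folklore] -/
instance (P : List GridPoint) (e : DrawnEdge) : Decidable (IsDrawnEdgeOf P e) := by
  unfold IsDrawnEdgeOf; infer_instance

/-- Decidability of `IsGridDrawing` (used only for the sanity checks below; the counting
function is classical). [folklore] -/
instance (P : List GridPoint) (D : List DrawnEdge) : Decidable (IsGridDrawing P D) := by
  unfold IsGridDrawing; infer_instance

/-- Drawn edges as bit strings. [cite: AroraBarak2009, §0.1] -/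
def encodingDrawnEdge : Encoding DrawnEdge Bool :=
  encodingNatBool.pairBool (encodingNatBool.pairBool encodingGridPoint.listBool)

/-- Instances `(P, D, s, t)` as bit strings. [cite: AroraBarak2009, §0.1] -/
def encodingDrawnGraphInstance : Encoding DrawnGraphInstance Bool :=
  encodingGridPoint.listBool.pairBool
    (encodingDrawnEdge.listBool.pairBool (encodingNatBool.pairBool encodingNatBool))

open Classical in
/-- **`GRIDHAMPATHCOUNT : {0,1}* → ℕ`** — `#HamPath` for graphs of maximum degree three given
with a congestion-free grid drawing: on the code of `(P, D, s, t)` with `IsGridDrawing P D` and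
`s, t < N = |P|`, the number of Hamiltonian `s`–`t` paths of the drawn graph; `0` on all other
strings (invalid drawings, non-codes). This is the problem `#HamPath-Plan3` of Lemma 4
restricted to — and presented by — the grid embeddings `E₀` that the proof of Theorem 7
computes from Lemma 4's planar outputs ("we apply our embedding algorithm to `G′` and obtain a
subgraph of a two-dimensional grid").
[cite: LiskiewiczOgiharaToda2003, Lemma 4 and §4, proof of Theorem 7 (E₀)] -/
def GRIDHAMPATHCOUNT : List Bool → ℕ := fun w =>
  match encodingDrawnGraphInstance.decode w with
  | some (P, D, s, t) =>
    if IsGridDrawing P D ∧ s < P.length ∧ t < P.length then hamPathCount P.length D s t else 0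
  | none => 0

/-- `GRIDHAMPATHCOUNT` on the code of a valid instance is the number of Hamiltonian `s`–`t`
paths. [cite: LiskiewiczOgiharaToda2003, §2.3 and §4] -/
theorem GRIDHAMPATHCOUNT_encode (P : List GridPoint) (D : List DrawnEdge) (s t : ℕ)
    (hD : IsGridDrawing P D) (hs : s < P.length) (ht : t < P.length) :
    GRIDHAMPATHCOUNT (encodingDrawnGraphInstance.encode (P, D, s, t)) =
      hamPathCount P.length D s t := by
  simp [GRIDHAMPATHCOUNT, encodingDrawnGraphInstance.decode_encode, hD, hs, ht]

/-- `GRIDHAMPATHCOUNT` vanishes on the code of an invalid drawing (the promise of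
`#HamPath-Plan3` made checkable). [cite: LiskiewiczOgiharaToda2003, §2.3 and §4] -/
theorem GRIDHAMPATHCOUNT_encode_of_not (P : List GridPoint) (D : List DrawnEdge) (s t : ℕ)
    (hD : ¬ IsGridDrawing P D) :
    GRIDHAMPATHCOUNT (encodingDrawnGraphInstance.encode (P, D, s, t)) = 0 := by
  simp [GRIDHAMPATHCOUNT, encodingDrawnGraphInstance.decode_encode, hD]

/-! ### The named sub-facts of Theorem 7 (1) -/

/-- **Theorem 7 (1), membership half**: `SAWCOUNT₁ ∈ #P` — the number of SAWs of a coded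
subgraph of `ℤ²` from the origin to a coded point with a coded length is a `#P` function (a
polynomial-time verifier accepts exactly the canonically padded codes of such walks; walks have
at most `|V(E)|` vertices, each of code length `O(|w|)`). Implicit in "complete for `#P`"; not
argued in print. Named fact, to be discharged by a verifier program in the tree's `TM2` model.
[cite: LiskiewiczOgiharaToda2003, Theorem 7 (version (1), membership in #P)] -/
def LOT2003_thm7_fixedLength_mem : Prop :=
  SAWCOUNT₁ ∈ SharpP

/-- **Lemma 4 composed with the embedding step of the proof of Theorem 7**: every `#P`
function is `≤ᵖ_{r-shift}`-reducible to `#HamPath` on graphs of maximum degree three presented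
with a congestion-free grid drawing (`GRIDHAMPATHCOUNT`). In print: `f ≤ᵖ_{r-shift}
#HamPath-Plan3` with shift `48r+12n+312m+25` (Lemma 4, via Proposition 2 and Lemma 3 and the
modified Garey–Johnson–Tarjan graph, whose vertices have degree three except `s`, `t` of degree
two), followed by "planar graphs can be embedded in two-dimensional grids in polynomial time …
In the case when the maximum degree is three, the embedding can be made so that there is no
vertex congestion" applied to `G′ = G + s′s + tt′` (proof of Theorem 7). Only the hardness
half of Lemma 4 is recorded. Named fact (its discharge is the bulk of the paper: §2.3–§3).
[cite: LiskiewiczOgiharaToda2003, Lemma 4 and §4, proof of Theorem 7 (construction of E₀)] -/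
def LOT2003_lemma4_grid : Prop :=
  ∀ f ∈ SharpP, RShiftReducible f GRIDHAMPATHCOUNT

/-- **The tower step of the proof of Theorem 7**: `#HamPath` on grid-drawn graphs of maximum
degree three is parsimoniously reducible to `SAWCOUNT₁` — from the drawing `E₀` of
`(G′, s′, t′)` build `E₂` (enlarge by `4`, then by `L`, insert `I(e) = (L² − λ(e))/2L` towers of
height `L` on every edge path so that every edge is realised by a path of length exactly `L²`),
put the image of `s′` at the origin, and ask for the SAWs to the image `τ` of `t′` of length
`h = L²(N+1)`: "the number of SAWs in `E₂` having length `h` is exactly the number of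
Hamiltonian paths in `G′`", i.e. `#HamPath(G′, s′, t′) = SAWCOUNT₁(E₂, τ, h)`; invalid
drawings are sent to an instance without such walks. Named fact.
[cite: LiskiewiczOgiharaToda2003, §4, proof of Theorem 7 (E₀ → E₁ → E₂, "Define R₁(x) = (E₂, τ, h)")] -/
def LOT2003_thm7_fixedLength_towers : Prop :=
  ParsimoniousReducible GRIDHAMPATHCOUNT SAWCOUNT₁

/-- **Assembly of Theorem 7 (1)** from the three sub-facts: membership, Lemma 4 with the
embedding step, and the tower step, glued by Proposition 1 (mixed form
`RShiftReducible.trans_parsimonious`: "the pair `(R₁, R₃)` witnesses that the types 1–3 … are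
each `#P`-complete under `≤ᵖ_{r-shift}`-reductions"). The discharge
`LOT2003_thm7_fixedLength_holds` is this theorem applied to the discharges of the sub-facts.
[cite: LiskiewiczOgiharaToda2003, Theorem 7 (version (1)) and its proof] -/
theorem LOT2003_thm7_fixedLength_of (hmem : LOT2003_thm7_fixedLength_mem)
    (h4 : LOT2003_lemma4_grid) (htow : LOT2003_thm7_fixedLength_towers) :
    LOT2003_thm7_fixedLength := by
  unfold LOT2003_thm7_fixedLength
  exact isSharpPCompleteRShift_of_parsimonious h4 htow hmem

/-- The same assembly for the barrier's first conjunct: under the three sub-facts and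
Theorem 7 (4), the barrier `GridSAWCountingSharpPComplete` holds.
[cite: LiskiewiczOgiharaToda2003, Theorem 7 (versions (1) and (4))] -/
theorem gridSAWCountingSharpPComplete_of (hmem : LOT2003_thm7_fixedLength_mem)
    (h4 : LOT2003_lemma4_grid) (htow : LOT2003_thm7_fixedLength_towers)
    (h7₄ : LOT2003_thm7_anyLength) :
    GridSAWCountingSharpPComplete :=
  ⟨LOT2003_thm7_fixedLength_of hmem h4 htow, h7₄⟩

/-! ### Sanity checks (small instances) -/

/-- The one-edge graph `0 — 1` drawn as the grid edge `(0,0) — (0,1)`. [folklore] -/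
def oneEdgeDrawing : List GridPoint × List DrawnEdge :=
  ([((0 : ℤ), (0 : ℤ)), (0, 1)], [(0, 1, [((0 : ℤ), (0 : ℤ)), (0, 1)])])

/-- `oneEdgeDrawing` is a valid congestion-free grid drawing (non-vacuity of `IsGridDrawing`).
[folklore] -/
theorem isGridDrawing_oneEdge : IsGridDrawing oneEdgeDrawing.1 oneEdgeDrawing.2 := by
  decide

/-- `[0, 1]` is a Hamiltonian `0`–`1` path of the one-edge graph (non-vacuity of `IsHamPath`).
[folklore] -/
theorem isHamPath_oneEdge : IsHamPath 2 oneEdgeDrawing.2 0 1 [0, 1] := by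
  refine ⟨by decide, rfl, rfl, ?_⟩
  simp only [List.isChain_cons_cons, List.isChain_singleton, and_true]
  exact ⟨_, List.mem_singleton.mpr rfl, Or.inl ⟨rfl, rfl⟩⟩

/-- The one-edge graph has exactly one Hamiltonian `0`–`1` path. [folklore] -/
theorem hamPathCount_oneEdge : hamPathCount 2 oneEdgeDrawing.2 0 1 = 1 := by
  rw [hamPathCount, Set.ncard_eq_one]
  refine ⟨[0, 1], Set.eq_singleton_iff_unique_mem.mpr ⟨isHamPath_oneEdge, fun l hl => ?_⟩⟩
  obtain ⟨hperm, hhead, -, -⟩ := hl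
  have hr : List.range 2 = [0, 1] := by decide
  rw [hr] at hperm
  have hlen := hperm.length_eq
  rcases l with _ | ⟨a, _ | ⟨b, _ | ⟨c, l'⟩⟩⟩
  · simp at hlen
  · simp at hlen
  · simp only [List.head?_cons, Option.some.injEq] at hhead
    subst hhead
    have hb : b ∈ [0, 1] := hperm.subset (by simp)
    have hnd : [0, b].Nodup := hperm.nodup_iff.mpr (by decide)
    simp only [List.mem_cons, List.not_mem_nil, or_false] at hb
    rcases hb with rfl | rfl
    · simp at hnd
    · rfl
  · simp at hlen

/-- A diagonal "edge" is not a grid drawing (the path `(0,0), (1,1)` is not a grid path).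
[folklore] -/
theorem not_isGridDrawing_diagonal :
    ¬ IsGridDrawing [((0 : ℤ), (0 : ℤ)), (1, 1)] [(0, 1, [((0 : ℤ), (0 : ℤ)), (1, 1)])] := by
  decide

end Literature.Barriers.CriticalPhenomena.GridSAW
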